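import Literature.NumberTheory.Sieve.Maynard2016Theorem1
import Literature.NumberTheory.Sieve.LargeGapsRankinConstantForms

/-!
# Large gaps between primes: Rankin 1938, Pintz 1997 and Ford–Green–Konyagin–Tao 2016 Theorem 1 hold

Trunk: AntSieve / parity (large-gaps ladder of `LargeGapsBetweenPrimes.lean`).

With Maynard's Theorem 1 proved in the tree for EVERY constant (`RankinConstant_holds (c) :
RankinConstant c`, file `Maynard2016Theorem1.lean`, from `Maynard2016.rankinConstant_all`), the three
named facts of the ladder that are instances or corollaries of «every Rankin constant» follow by the
tree's own one-line implications: Pintz 1997 (`c = 2e^γ`, `pintz1997_of_rankinConstant`), Rankin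
1938 (`c = 1/3`, `rankin1938_of_pintz1997`) and Ford–Green–Konyagin–Tao 2016 Theorem 1 (runs of
`≥ R · log X log₂ X log₄ X/(log₃ X)²` consecutive composites below `X` for every `R`,
`fgkt2016_theorem1_of_rankinConstant`).  D-0026 bookkeeping: proof terms are existing theorems of
the tree composed; no statement, definition or attribute is edited; no new named fact.

## References

* K. Ford, B. Green, S. Konyagin, T. Tao, *Large gaps between consecutive prime numbers*, Ann. of
  Math. (2) 183 (2016), 935–974, Theorem 1 and p. 936. [FordGreenKonyaginTao2016]
* J. Pintz, *Very large gaps between consecutive primes*, J. Number Theory 63 (1997). [Pintz1997]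
* R. A. Rankin, *The difference between consecutive prime numbers*, J. London Math. Soc. 13 (1938). [Rankin1938]
* J. Maynard, *Large gaps between primes*, Ann. of Math. (2) 183 (2016), Theorem 1. [Maynard2016LargeGaps]
-/

namespace Literature.NumberTheory.Sieve

/-- **Pintz 1997** (`G(X) ≥ (2e^γ + o(1)) log X log₂ X log₄ X/(log₃ X)²`), unconditionally: the
instance `c = 2e^γ` of `RankinConstant_holds` (`pintz1997_of_rankinConstant`).
[cite: Pintz1997, main theorem (via FordGreenKonyaginTao2016, p. 936)] -/
theorem Pintz1997_largeGaps_holds : Literature.NumberTheory.Sieve.Pintz1997_largeGaps :=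
  pintz1997_of_rankinConstant RankinConstant_holds

/-- **Rankin 1938** (`c = 1/3`), unconditionally: from Pintz's constant by monotonicity
(`rankin1938_of_pintz1997`). [cite: Rankin1938, main theorem (via FordGreenKonyaginTao2016, p. 936)] -/
theorem Rankin1938_largeGaps_holds : Literature.NumberTheory.Sieve.Rankin1938_largeGaps :=
  rankin1938_of_pintz1997 Pintz1997_largeGaps_holds

/-- **Ford–Green–Konyagin–Tao 2016, Theorem 1** («Let `R > 0`. Then for any sufficiently large `X`,
there are at least `R log X log₂ X log₄ X/(log₃ X)²` consecutive composite natural numbers not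
exceeding `X`» — Erdős's question), unconditionally: `fgkt2016_theorem1_of_rankinConstant` applied
to `RankinConstant_holds` (the tree's proof of every Rankin constant runs through Maynard 2016).
[cite: FordGreenKonyaginTao2016, Theorem 1] -/
theorem FordGreenKonyaginTao2016_theorem1_holds :
    Literature.NumberTheory.Sieve.FordGreenKonyaginTao2016_theorem1 :=
  fgkt2016_theorem1_of_rankinConstant RankinConstant_holds

end Literature.NumberTheory.Sieve
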